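import Summits.Ventures.LatticeQCDFlow.TrivializingMaps.WilsonFisherZerosPolynomial
import Summits.Ventures.LatticeQCDFlow.TrivializingMaps.WilsonVarianceFloorAllCouplings

/-!
HONEST FRAMING: exact (Metropolis-corrected) sampling algorithms for lattice gauge theory; figures
of merit are autocorrelation/cost numbers at stated couplings and volumes; no continuum-physics
claim.

# WilsonFisherZerosEveryCoupling — `SU(n)`: `dist(u, F_{Z_L}) ≤ C·(1 + u²)` FOR EVERY REAL COUPLING
# `u ≥ 0` AND EVERY VOLUME `L ≥ 2`, ONE CONSTANT `C = C(d, n)` (lean-2 GEN-10, ours)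

Venture-side (OURS).  Cell `lqcd-flow` (pub-lqcd), unit `pub-lqcd-lean-2-g10`, 2026-08-23.  Gluing of
`WilsonFisherZerosPolynomial` (`u ≥ 1`: a zero within `C₁·u²`, from theory2's (SH_W) at `β₀ = 1`) and
GEN-9's `wilson_exists_fisherZero_near_allCouplings` (every compact `G`: a zero within
`4N d² 3^d e^{c'|u|}/v_ρ`, used on the window `0 ≤ u ≤ 1`), through the dictionary
`ambWilsonAction ∘ ι = wilsonAction ρ₀` (`StrongCoupling.ambWilsonAction_coeConfig`):

* **`wilson_exists_fisherZero_near_everyCoupling`**: for `n ≥ 2`, `d ≥ 2` there is `C = C(d, n) > 0` with: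
  for EVERY `L ≥ 2` and EVERY real `u ≥ 0` the finite-volume `SU(n)` Wilson partition function `Z_L` has a
  zero `s₀` with **`|s₀ − u| ≤ C·(1 + u²)`**; **`wilson_infDist_zeroSet_le_everyCoupling`**:
  `dist(u, F_{Z_L}) ≤ C·(1 + u²)`.

NOT CLAIMED: the value of `C` (it inherits `e^{c'}/v_ρ` with `c' = 2nK(1+4K)`, `K = (d+1)d²`, and theory2's
`1/c(d,n,1)`); negative couplings (covered by GEN-9's law, exponential rate); anything about the location
of zeros beyond their distance to the real axis points; cost / autocorrelation / continuum statements.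
Literature grade (cell rule): corollary; new typing.
-/

noncomputable section

open MeasureTheory ProbabilityTheory Complex Metric Set
open Literature.MathematicalPhysics.QuantumFieldTheory
open Literature.MathematicalPhysics.QuantumFieldTheory.Luscher2010
open Literature.MathematicalPhysics.QuantumFieldTheory.WilsonFlow (coeConfig)
open scoped Matrix Matrix.Norms.Frobenius ContDiff

namespace Summit.Ventures.LatticeQCDFlow.TrivializingMaps

section SUN

variable {d n : ℕ}

/-- `SU(n)` in its defining representation `ρ₀` is unitary-valued (bookkeeping). [folklore] -/
theorem defRep_mem_unitaryGroup (g : Matrix.specialUnitaryGroup (Fin n) ℂ) :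
    StrongCoupling.defRep n g ∈ Matrix.unitaryGroup (Fin n) ℂ :=
  Matrix.specialUnitaryGroup_le_unitaryGroup g.2

/-- The two spellings of `Z_L` agree: Lüscher's ambient `∫ D[U] e^{−s S_W(ιU)}` is Wave 0's
`∫ D[U] e^{−s S_W^{ρ₀}(U)}`. [folklore] -/
theorem complexMGF_ambWilsonAction_eq {L : ℕ} [NeZero L] (s : ℂ) :
    complexMGF (fun U : GaugeConfig d L (Matrix.specialUnitaryGroup (Fin n) ℂ) =>
        -ambWilsonAction (coeConfig U)) (trivialMeasure (Matrix.specialUnitaryGroup (Fin n) ℂ) d L) s =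
      complexMGF (fun U => -wilsonAction (StrongCoupling.defRep n) U)
        (trivialMeasure (Matrix.specialUnitaryGroup (Fin n) ℂ) d L) s := by
  have h : (fun U : GaugeConfig d L (Matrix.specialUnitaryGroup (Fin n) ℂ) =>
      -ambWilsonAction (coeConfig U)) = fun U => -wilsonAction (StrongCoupling.defRep n) U := by
    funext U
    rw [StrongCoupling.ambWilsonAction_coeConfig]
  rw [h]

/-- **A FISHER ZERO WITHIN `C·(1 + u²)` OF EVERY REAL COUPLING `u ≥ 0`, EVERY VOLUME** (`SU(n)`, `n ≥ 2`,
`d ≥ 2`, one `C = C(d, n) > 0` for all `L ≥ 2` and all `u ≥ 0`). [ours] -/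
theorem wilson_exists_fisherZero_near_everyCoupling (hn : 2 ≤ n) (hd : 2 ≤ d) :
    ∃ C : ℝ, 0 < C ∧ ∀ (L : ℕ) [NeZero L], 2 ≤ L → ∀ u : ℝ, 0 ≤ u →
      ∃ s₀ : ℂ, ‖s₀ - u‖ ≤ C * (1 + u ^ 2) ∧
        complexMGF (fun U => -ambWilsonAction (coeConfig U))
          (trivialMeasure (Matrix.specialUnitaryGroup (Fin n) ℂ) d L) s₀ = 0 := by
  -- `u ≥ 1`: the polynomial law at `β₀ = 1`
  obtain ⟨C₁, hC₁, hpoly⟩ :=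
    wilson_exists_fisherZero_near_polynomial (d := d) (n := n) hn hd (β₀ := 1) one_pos
  -- `0 ≤ u ≤ 1`: GEN-9's every-coupling law with `|u| ≤ 1`
  set v : ℝ := variance (fun g : ↥(Matrix.specialUnitaryGroup (Fin n) ℂ) =>
      ((StrongCoupling.defRep n) g).trace.re)
    (haarProbability ↥(Matrix.specialUnitaryGroup (Fin n) ℂ)) with hv
  have hvpos : 0 < v := Theory2.WilsonSpecificHeat.haarVar_pos hn
  set c' : ℝ := 2 * n * ((d + 1) * d ^ 2 : ℕ) * (1 + 4 * ((d + 1) * d ^ 2 : ℕ)) with hc'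
  set K₁ : ℝ := 4 * n * ((d ^ 2 * 3 ^ d : ℕ) : ℝ) * Real.exp (1 * c') / v with hK₁
  have hK₁pos : 0 < K₁ := by
    have : (0 : ℝ) < n := by exact_mod_cast (show 0 < n by omega)
    have : (0 : ℝ) < ((d ^ 2 * 3 ^ d : ℕ) : ℝ) := by
      have hd0 : 0 < d := by omega
      exact_mod_cast Nat.mul_pos (Nat.pow_pos hd0) (Nat.pow_pos (by norm_num))
    positivity
  refine ⟨C₁ + K₁, by positivity, fun L _ hL u hu0 => ?_⟩
  by_cases hu1 : 1 ≤ u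
  · obtain ⟨s₀, hs₀, hz⟩ := hpoly L hL u hu1
    refine ⟨s₀, hs₀.trans ?_, hz⟩
    nlinarith [sq_nonneg u, hK₁pos.le, hC₁.le]
  · rw [not_le] at hu1
    obtain ⟨s₀, hs₀, hz⟩ := wilson_exists_fisherZero_near_allCouplings (d := d) (L := L)
      (StrongCoupling.defRep n) hd hL continuous_subtype_val defRep_mem_unitaryGroup hvpos u
    refine ⟨s₀, hs₀.trans ?_, ?_⟩
    · -- `|u| ≤ 1` ⇒ the GEN-9 radius is at most `K₁ ≤ (C₁ + K₁)(1 + u²)`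
      have hexp : Real.exp (|u| * c') ≤ Real.exp (1 * c') := by
        refine Real.exp_le_exp.2 (mul_le_mul_of_nonneg_right ?_ (by rw [hc']; positivity))
        rw [abs_of_nonneg hu0]; exact hu1.le
      have hle : 4 * n * ((d ^ 2 * 3 ^ d : ℕ) : ℝ) * Real.exp (|u| * c') / v ≤ K₁ := by
        rw [hK₁]
        exact div_le_div_of_nonneg_right (mul_le_mul_of_nonneg_left hexp (by positivity)) hvpos.le
      rw [← hv, ← hc']
      refine hle.trans ?_
      nlinarith [sq_nonneg u, hK₁pos.le, hC₁.le]
    · rwa [complexMGF_ambWilsonAction_eq]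

/-- **`dist(u, F_{Z_L}) ≤ C·(1 + u²)` for every `u ≥ 0` and every `L ≥ 2`** (`SU(n)`, `n ≥ 2`, `d ≥ 2`):
Fisher zeros of the finite-volume `SU(n)` Wilson theory accompany the whole non-negative real coupling
axis at a distance growing at most quadratically, with one volume-independent constant. [ours] -/
theorem wilson_infDist_zeroSet_le_everyCoupling (hn : 2 ≤ n) (hd : 2 ≤ d) :
    ∃ C : ℝ, 0 < C ∧ ∀ (L : ℕ) [NeZero L], 2 ≤ L → ∀ u : ℝ, 0 ≤ u →
      infDist (u : ℂ) {s : ℂ | complexMGF (fun U => -ambWilsonAction (coeConfig U))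
        (trivialMeasure (Matrix.specialUnitaryGroup (Fin n) ℂ) d L) s = 0} ≤ C * (1 + u ^ 2) := by
  obtain ⟨C, hC, h⟩ := wilson_exists_fisherZero_near_everyCoupling (d := d) (n := n) hn hd
  refine ⟨C, hC, fun L _ hL u hu => ?_⟩
  obtain ⟨s₀, hs₀, hz⟩ := h L hL u hu
  refine (infDist_le_dist_of_mem (by exact hz)).trans ?_
  rwa [dist_comm, dist_eq_norm]

end SUN

end Summit.Ventures.LatticeQCDFlow.TrivializingMaps

end
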